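import Summits.QuantumFields.YangMills.Theorems.BalabanUVNodesN15KingModelHeatKernelTorusDistance
import Summits.QuantumFields.YangMills.Theorems.BalabanUVNodesN15KingModelHeatKernelFreeKernelPowerLaw
import HarnessLib

/-!
# BalabanUVNodes ∕ N15 — THE KING-MODEL RUNG (PART Ϣ-l): PART Ϣ BY NAME — the η-uniform power law in PHYSICAL units (`O(η⁴∕D_phys⁴)` decoupling), the package, and what the curved case adds
# (Track A, DAG node N15 = NE2; FAN-OUT v1.1 §N15 s3 «KING-MODEL RUNG … + what the curved case adds»; count-neutral)

HONEST FRAMING.  Count-neutral (cell `pub-ymgap`, seat `pub-ymgap-dag-n15-e` g55; `--supports stmt-QuantumFields-27247 --as helper` = K3ᴬ).  Packaging file for PART Ϣ (files Ϣ-a…Ϣ-k): no new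
analysis.  (§1) PHYSICAL UNITS: on the fine torus `(ℤ∕LM₀)⁴` the lattice distance is `L` times the physical one, so a physical separation `D_phys > 0` between the supports means
`tdistT ≥ L·D_phys` and Ϣ-j's decoupling reads ★★★★ **`abs_log_det_covLapF_decoupling_physical`**: `|Δ₁₂ ln det M| ≤ 16|n|⁴·(34016 + 10∕m²)²·(η⁴∕D_phys⁴)·#Z₁·#Z₂` (`η = 1∕L`) — the interaction of
two distant changes of the background in the fine Gaussian normalisation vanishes like `η⁴` PER BOND PAIR at fixed physical separation (the number of bonds in a fixed physical region grows like
`η⁻⁴`, so per pair of physical regions the bound is `O(1)·D_phys⁻⁴` — the dimensionless four-dimensional cluster law); likewise ★★★ `king_green_powerLaw_physical`: `L²|G(x,y)| ≤ (34016+10∕m²)·η²∕d_phys²`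
when `tdistT(x,y) ≥ L·d_phys`.  (§2) ★★★★ **`king_heatKernel_package`**: the five headline statements of PART Ϣ by name.  (§3) ★★★ **`king_heatKernel_what_the_curved_case_adds`**: for the FINE
covariance NOTHING (Kato's domination transfers every flat entry bound to every unitary background — typed as an implication valid for ANY flat majorant `B(x,y)`); what remains curved-only is
the block term `aQ(U)^*Q(U)` (full propagator, `Δ_eff`) — door t3⁶¹.  NOT Bałaban's (3.42); NOT a node discharge; nothing continuum ∕ ℝ⁴ ∕ OS ∕ mass gap ∕ Clay.
PRIOR TREE ART (by name): PARTS Ϣ-h∕Ϣ-i∕Ϣ-j∕Ϣ-k; Ϯ-n §1 `norm_covLapF_inv_entry_le_lapF_inv_of_norm_le`; Ͱ-l `l2_opNorm_of_mem_unitaryGroup_le`.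
Dedup (rg at filing): basename 0 files; needles `abs_log_det_covLapF_decoupling_physical|king_green_powerLaw_physical|king_heatKernel_package|king_heatKernel_what_the_curved_case_adds` 0 tree files.
Locators: [King1986] (2.13) p.653 (`η = L^{−1}` scaling), (3.94)–(3.96) p.669, (4.4) p.670, (4.35) p.674; [Balaban1985BackgroundPropagators] (3.42) p.397, Thm 3.4 p.400; [Balaban1983RegularityDecay] (2.43) p.584.  0 `sorry`, 0 `def`.
-/

noncomputable section

open Real Set Finset Matrix
open scoped BigOperators Matrix.Norms.L2Operator

namespace Summit.QuantumFields.YangMills.BalabanUVNodes.N15KingModelRung.HeatKernel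

open Literature.MathematicalPhysics.QuantumFieldTheory.Balaban1983to89.B5Prop11Plancherel (Tor fine unitVec)
open Literature.MathematicalPhysics.QuantumFieldTheory.Balaban1983to89.Beta.WoodburyFibre (cM)
open Literature.MathematicalPhysics.QuantumFieldTheory.King1986.Torus (lapF tdistT tdistT_nonneg)
open Summit.QuantumFields.YangMills.BalabanUVNodes.N15KingModelRung.Covariant (covLapF l2_opNorm_of_mem_unitaryGroup_le)
open Summit.QuantumFields.YangMills.BalabanUVNodes.N15KingModelRung.Analytic (norm_covLapF_inv_entry_le_lapF_inv_of_norm_le)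
open Summit.QuantumFields.YangMills.BalabanUVNodes.N15KingModelRung.TorusSpectral (freeKer)

/-! ## §1 Physical units -/

/-- `(34016 + 10∕m²)∕(1 + (L·d)²) ≤ (34016 + 10∕m²)·η²∕d²` with `η = 1∕L` (`d > 0`). [folklore] -/
theorem powerLaw_const_div_le_physical {m2 : ℝ} (hm : 0 < m2) {L d : ℝ} (hL : 0 < L) (hd : 0 < d) :
    (34016 + 10 / m2) / (1 + (L * d) ^ 2) ≤ (34016 + 10 / m2) / (L ^ 2 * d ^ 2) := by
  apply div_le_div_of_nonneg_left (by positivity) (by positivity)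
  nlinarith [mul_pos hL hd]

section King

variable (L M₀ : ℕ) [NeZero L] [NeZero M₀] {m2 : ℝ}

/-- ★★★ **THE CLUSTER PROPERTY IN PHYSICAL UNITS**: if `tdistT(x,y) ≥ L·d_phys` (`d_phys > 0` a physical distance, `η = 1∕L`) then `L²|G(x,y)| ≤ (34016 + 10∕m²)·η²∕d_phys²` — King's covariance in
units of the hopping is `O(η²)` at fixed physical separation, uniformly in the volume. [cite: King1986, (2.13) p.653, (4.4) p.670, (4.35) p.674] -/
theorem king_green_powerLaw_physical (hm : 0 < m2) (x y : Tor (fine L (cM M₀))) {dphys : ℝ} (hd : 0 < dphys) (hsep : (L : ℝ) * dphys ≤ tdistT (fine L (cM M₀)) x y) :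
    (L : ℝ) ^ 2 * |(lapF (fine L (cM M₀)) ((L : ℝ) ^ 2) m2)⁻¹ x y| ≤ (34016 + 10 / m2) / ((L : ℝ) ^ 2 * dphys ^ 2) := by
  have hL : (0 : ℝ) < L := by exact_mod_cast Nat.pos_of_ne_zero (NeZero.ne L)
  refine (king_green_powerLaw_tdistT L M₀ hm x y).trans ?_
  refine le_trans ?_ (powerLaw_const_div_le_physical hm hL hd)
  apply div_le_div_of_nonneg_left (by positivity) (by positivity)
  have h0 : 0 ≤ (L : ℝ) * dphys := by positivity
  nlinarith [mul_le_mul hsep hsep h0 (tdistT_nonneg (fine L (cM M₀)) x y)]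

end King

section DecouplingPhysical

variable (L M₀ : ℕ) [NeZero L] [NeZero M₀] {n : Type*} [Fintype n] [DecidableEq n] [Nonempty n]
variable {m2 : ℝ} (hm : 0 < m2)
variable {U₀ U₁ U₂ : Tor (fine L (cM M₀)) × Fin 4 → Matrix n n ℝ} (hU₀ : ∀ b, U₀ b ∈ Matrix.unitaryGroup n ℝ) (hU₁ : ∀ b, U₁ b ∈ Matrix.unitaryGroup n ℝ)
  (hU₂ : ∀ b, U₂ b ∈ Matrix.unitaryGroup n ℝ)
variable {Z₁ Z₂ : Finset (Tor (fine L (cM M₀)) × Fin 4)} (h₁ : ∀ b, b ∉ Z₁ → U₁ b = U₀ b) (h₂ : ∀ b, b ∉ Z₂ → U₂ b = U₀ b) (hZ : Disjoint Z₁ Z₂)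
variable {Dphys : ℝ} (hD : 0 < Dphys)
  (hsep : ∀ x y : Tor (fine L (cM M₀)), (∃ b ∈ Z₁, x = b.1 ∨ x = b.1 + unitVec (fine L (cM M₀)) b.2) → (∃ b ∈ Z₂, y = b.1 ∨ y = b.1 + unitVec (fine L (cM M₀)) b.2) →
    (L : ℝ) * Dphys ≤ tdistT (fine L (cM M₀)) x y)
include hm hU₀ hU₁ hU₂ h₁ h₂ hZ hD hsep

/-- ★★★★ **THE DECOUPLING IN PHYSICAL UNITS — `O(η⁴∕D_phys⁴)` PER BOND PAIR**: if the endpoints of `Z₁` and `Z₂` are at PHYSICAL distance `≥ D_phys > 0` (lattice distance `≥ L·D_phys`), then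
`|ln det M(U₁+U₂−U₀) − ln det M(U₁) − ln det M(U₂) + ln det M(U₀)| ≤ 16|n|⁴·((34016 + 10∕m²)·η²∕D_phys²)²·#Z₁·#Z₂` with `η = 1∕L`, for every `L ≥ 1` and every volume `M₀ ≥ 1`.
[cite: King1986, (2.13) p.653, (3.94)–(3.96) p.669, (4.4) p.670; Balaban1985BackgroundPropagators, (3.42) p.397, Thm 3.4 p.400] -/
theorem abs_log_det_covLapF_decoupling_physical :
    |Real.log (covLapF (fine L (cM M₀)) ((L : ℝ) ^ 2) m2 (U₁ + U₂ - U₀)).det - Real.log (covLapF (fine L (cM M₀)) ((L : ℝ) ^ 2) m2 U₁).det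
        - Real.log (covLapF (fine L (cM M₀)) ((L : ℝ) ^ 2) m2 U₂).det + Real.log (covLapF (fine L (cM M₀)) ((L : ℝ) ^ 2) m2 U₀).det|
      ≤ 16 * (Fintype.card n : ℝ) ^ 4 * ((34016 + 10 / m2) / ((L : ℝ) ^ 2 * Dphys ^ 2)) ^ 2 * Z₁.card * Z₂.card := by
  have hL : (0 : ℝ) < L := by exact_mod_cast Nat.pos_of_ne_zero (NeZero.ne L)
  have hD0 : 0 ≤ (L : ℝ) * Dphys := by positivity
  have h := abs_log_det_covLapF_decoupling_powerLaw_tdistT_eta_uniform L M₀ hm hU₀ hU₁ hU₂ h₁ h₂ hZ hD0 hsep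
  refine h.trans ?_
  have hle := powerLaw_const_div_le_physical hm hL hD
  have h0 : 0 ≤ (34016 + 10 / m2) / (1 + ((L : ℝ) * Dphys) ^ 2) := by positivity
  have hsq := pow_le_pow_left₀ h0 hle 2
  have hZZ : (0 : ℝ) ≤ (Z₁.card : ℝ) * Z₂.card := by positivity
  have hn : (0 : ℝ) ≤ 16 * (Fintype.card n : ℝ) ^ 4 := by positivity
  calc 16 * (Fintype.card n : ℝ) ^ 4 * ((34016 + 10 / m2) / (1 + ((L : ℝ) * Dphys) ^ 2)) ^ 2 * Z₁.card * Z₂.card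
      = 16 * (Fintype.card n : ℝ) ^ 4 * ((34016 + 10 / m2) / (1 + ((L : ℝ) * Dphys) ^ 2)) ^ 2 * ((Z₁.card : ℝ) * Z₂.card) := by ring
    _ ≤ 16 * (Fintype.card n : ℝ) ^ 4 * ((34016 + 10 / m2) / ((L : ℝ) ^ 2 * Dphys ^ 2)) ^ 2 * ((Z₁.card : ℝ) * Z₂.card) :=
        mul_le_mul_of_nonneg_right (mul_le_mul_of_nonneg_left hsq hn) hZZ
    _ = _ := by ring

end DecouplingPhysical

/-! ## §2 PART Ϣ by name -/

/-- ★★★★ **PART Ϣ PACKAGE (by name)**: (i) cubic four-torus, every `c > 0`, `m² > 0`: `c|G(x,y)| ≤ 34016∕(1+tdistT(x,y)²) + 8c∕(m²K₀⁴)`; (ii) King's scaling: `L²|G(x,y)| ≤ (34016+10∕m²)∕(1+tdistT(x,y)²)`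
for every `L, M₀`; (iii) infinite lattice: `c·|K_∞(z)| ≤ 34016∕(1+z_ν²)` for every `ν`. [cite: King1986, (2.13) p.653, (4.4) p.670, (4.35) p.674; Balaban1983RegularityDecay, (2.43) p.584] -/
theorem king_heatKernel_package {K₀ : ℕ} [NeZero K₀] {c m2 : ℝ} (hc : 0 < c) (hm : 0 < m2) (L M₀ : ℕ) [NeZero L] [NeZero M₀] :
    (∀ x y : Tor (cM K₀), c * |(lapF (cM K₀) c m2)⁻¹ x y| ≤ 34016 / (1 + tdistT (cM K₀) x y ^ 2) + 8 * c / (m2 * (K₀ : ℝ) ^ 4))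
    ∧ (∀ x y : Tor (fine L (cM M₀)), (L : ℝ) ^ 2 * |(lapF (fine L (cM M₀)) ((L : ℝ) ^ 2) m2)⁻¹ x y| ≤ (34016 + 10 / m2) / (1 + tdistT (fine L (cM M₀)) x y ^ 2))
    ∧ (∀ (z : Fin 4 → ℤ) (ν : Fin 4), c * |freeKer c m2 z| ≤ 34016 / (1 + ((z ν : ℤ) : ℝ) ^ 2)) :=
  ⟨fun x y => mul_abs_lapF_inv_le_powerLaw_tdistT hc hm x y, fun x y => king_green_powerLaw_tdistT L M₀ hm x y,
    fun z ν => mul_abs_freeKer_le_powerLaw hc hm z ν⟩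

/-! ## §3 What the curved case adds -/

/-- ★★★ **WHAT THE CURVED CASE ADDS — NOTHING, FOR THE FINE COVARIANCE**: on EVERY torus `Π_μℤ∕K_μ`, for every unitary link field `U` and ANY flat majorant `B`: if King's `A = 0` kernel satisfies
`c·(lapF)⁻¹(x,y) ≤ B(x,y)` then every fibre entry of the covariant fine covariance satisfies `c·‖((−cΔ_U+m²)⁻¹)_{(x,i),(y,j)}‖ ≤ B(x,y)` (Kato's domination, Ϯ-n §1 BY NAME). So PART Ϣ's power
law, Ε-d's mass decay and Ϯ-e's diagonal all transfer verbatim; the block term `aQ(U)^*Q(U)` of the full propagator has NO such entrywise domination (door t3⁶¹).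
[cite: Balaban1985BackgroundPropagators, Thm 3.4 p.400, (3.42) p.397; King1986, (4.4) p.670] -/
theorem king_heatKernel_what_the_curved_case_adds {d : ℕ} (K : Fin (d + 1) → ℕ) [∀ μ, NeZero (K μ)] {c m2 : ℝ} (hc : 0 < c) (hm : 0 < m2)
    {𝕜 : Type*} [RCLike 𝕜] {n : Type*} [Fintype n] [DecidableEq n] {U : Tor K × Fin (d + 1) → Matrix n n 𝕜} (hU : ∀ b, U b ∈ Matrix.unitaryGroup n 𝕜)
    {B : Tor K → Tor K → ℝ} (hB : ∀ x y, c * (lapF K c m2)⁻¹ x y ≤ B x y) (x y : Tor K) (i j : n) :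
    c * ‖(covLapF K c m2 U)⁻¹ (x, i) (y, j)‖ ≤ B x y := by
  have hW : ∀ b, ‖U b‖ ≤ 1 + 0 := fun b => by rw [add_zero]; exact l2_opNorm_of_mem_unitaryGroup_le (hU b)
  have hk := norm_covLapF_inv_entry_le_lapF_inv_of_norm_le K hc.le hm hW x y i j
  exact (mul_le_mul_of_nonneg_left hk hc.le).trans (hB x y)

end Summit.QuantumFields.YangMills.BalabanUVNodes.N15KingModelRung.HeatKernel

end
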